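import Summits.AtomisticToContinuum.BoseEinsteinCondensation.Theorems.BECInsertionCorrectorCorrectorClosureDensityUniformDichotomyBudget
import Summits.AtomisticToContinuum.BoseEinsteinCondensation.Theses.BECInsertionCorrector
import Summits.AtomisticToContinuum.BoseEinsteinCondensation.Theses.BECPhaseQuadratureSumRule
import Summits.AtomisticToContinuum.BoseEinsteinCondensation.Theorems.BECPhaseQuadratureSumRuleCurrentSumRule
import Summits.AtomisticToContinuum.BoseEinsteinCondensation.Theorems.BECPhaseQuadratureSumRuleMinimiserRegularity
import HarnessLib

/-!
# Crux `CorrectorClosure` (stmt-AtomisticToContinuum-12058), line `volume-homotopy-sum-rule-domination` —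
# registered stub `stub_densityUniformDichotomy` (S4): the engine of PQSR re-instantiated along the volume path

Supports (does not close) stmt-AtomisticToContinuum-12058, route `BECInsertionCorrector`.

**Statement.** For a smooth-class `v` (finite, `C²` as `x ↦ v(|x|)`, edge condition): IF the long-wave structure
bound holds density-uniformly for all `N ≥ 1` (stub S1, the conclusion of `stub_longWaveStructureOfSRB`, consumed
as the hypothesis `hLW`), the non-condensate remainders are density-uniformly small (S2, hypothesis `hR`) and the
condensate number concentrates density-uniformly (S3, hypothesis `hC`), THEN there is `ρ₀ > 0` such that for all
large `N`, EVERY box `L ≥ (N/ρ₀)^{1/3}` and every exact minimiser `Ψ` at `(N, L)`, `n₀ ≤ N/4 ∨ 3N/4 ≤ n₀`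
(`n₀ = condensateOccupation N L Ψ.ψ`).

**Proof.** The proved bookkeeping `SumRuleChainGlue.dichotomy_of_instances` (item 12627 (i)–(v)) is already stated
at a general torus state of `n + 2` bodies in a box `L` with `ρ L³ = n + 2`; apply it at coupling `t = 1` with the
LOCAL density `ρ := N/L³ ≤ ρ₀` (so `L ≥ sideLength ρ₀ N ⟺ ρ ≤ ρ₀`, `dud_density_le_of_sideLength_le`), uniformly
over all such `L` with ONE `N`-threshold (those of S2, S3, and `sideLength ρ₀ N > 4R₀`):
* free case `a(v) = 0`: `v(|x|) ≡ 0`, the constant state is a minimiser, `n₀ = N` for every minimiser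
  (`dud_free_case`);
* interacting case, constants of the glue (`R₀ = max(range, 1)`, `Λ²a = 1024πR₀`, `ζ = ε_R = 1/64`,
  `ε_L = 25/4096`, `K = Λ`), `ρ₀` = half the least of the thresholds of S2, S3, S1, the `(N, L)`-uniform
  Dyson–LSSY budget `dud_groundStateEnergy_le` (`E₀ ≤ 16πR₀ρN`, `N ≥ 2`, `L > 4R₀`), `exists_errorThreshold` and
  `(4R₀²Λ²a)⁻¹` (`two_mul_le_ell`); for the `C³` minimiser `Ψm` of `minimiserRegularity_proof` (item 12619):
  non-empty infrared window `1 ≤ LΛ√(ρa)/2π` (forcing `ℓ < L` and the box-fit side condition `L ≤ Λ²Na` of S1) ⇒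
  `dichotomy_of_instances` with `currentSumRule_proof` (item 12618), S2, S1, S3, budget; empty window ⇒
  `dud_dichotomy_of_emptyWindow` (aux file); finally `n₀(Ψ) = n₀(Ψm)` for the given minimiser `Ψ`
  (`dud_condensateOccupation_eq_of_minimisers`, from the proved `NearMinimiserStability`, item 11788).
The `d = 3` input of the line sits inside `dichotomy_of_instances` (`Σ_IR 1/|k| = O(L·M²)`).

## References

* [Stringari1995] S. Stringari, *Sum rules and Bose–Einstein condensation*, §2.3 (19)–(23).
* [LiebSeiringerYngvason2005] E. H. Lieb, R. Seiringer, J. Yngvason, *Justification of c-number substitutions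
  in bosonic Hamiltonians*, Thm 6.2.
* [LSSY2005] E. H. Lieb, R. Seiringer, J. P. Solovej, J. Yngvason, *The Mathematics of the Bose Gas and its
  Condensation*, Thm 2.2 (2.14).
-/

noncomputable section

open MeasureTheory Filter Matrix
open scoped ENNReal NNReal BigOperators ComplexConjugate

namespace Summit.AtomisticToContinuum.BoseEinsteinCondensation.Theorems.CorrectorClosure.VolumeHomotopySumRuleDomination

open Literature.MathematicalPhysics.QuantumManyBody.BoseGas
open Summit.AtomisticToContinuum.BoseEinsteinCondensation.Theses.BECInsertionCorrector
open Summit.AtomisticToContinuum.BoseEinsteinCondensation.Theorems.SumRuleChainGlue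

/-! ### S4: the engine along the volume path -/

/-- **S4 `stub_densityUniformDichotomy` — PQSR's engine `SumRuleChainGlue` (item 12627 (i)–(v)) re-instantiated
along the VOLUME path: local density `ρ_L = N/L³` for `ρ`, coupling `t = 1`.** For a smooth-class `v`: if the
long-wave structure bound holds density-uniformly for all `N ≥ 1` (S1), the non-condensate remainders are
density-uniformly small (S2) and the condensate number concentrates density-uniformly (S3), then there is
`ρ₀ > 0` such that for all large `N`, every box `L ≥ (N/ρ₀)^{1/3}` and every exact minimiser `Ψ` at `(N, L)`,
`n₀ ≤ N/4 ∨ 3N/4 ≤ n₀`.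
Proof. Free case `a(v) = 0`: `v(|x|) ≡ 0` (`pot_eq_zero_of_scatteringLength_eq_zero`), the constant state is
a minimiser with `n₀ = N` and all minimisers share `n₀` (`dud_free_case`). Interacting case, `N = n + 2`:
constants `R₀ = max(range, 1)`, `Λ²a = 1024πR₀`, `ζ = ε_R = 1/64`, `ε_L = 25/4096`, `K = Λ`; `ρ₀` is half the
minimum of the thresholds of S2, S3, S1, the `(N, L)`-uniform Dyson–LSSY budget `dud_groundStateEnergy_le`,
`exists_errorThreshold` and `(4R₀²Λ²a)⁻¹` (`two_mul_le_ell`); `N` beyond the `N`-thresholds of S2, S3 and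
`sideLength ρ₀ N > 4R₀`. Given `L ≥ sideLength ρ₀ N` put `ρ := N/L³ ≤ ρ₀` (`dud_density_le_of_sideLength_le`;
the hypotheses' `sideLength ρ' N ≤ L` follow by `sideLength_le_sideLength`). For the `C³` minimiser `Ψm` of
`minimiserRegularity_proof`: if the infrared window is non-empty (`1 ≤ LΛ√(ρa)/2π`, which forces `ℓ < L` and
the box-fit side condition `L ≤ Λ²Na` of S1), `dichotomy_of_instances` at `t = 1` with `currentSumRule_proof`
(item 12618), S2, S1, S3 and the budget; if it is empty, `dud_dichotomy_of_emptyWindow`. Finally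
`n₀(Ψ) = n₀(Ψm)` (`dud_condensateOccupation_eq_of_minimisers`). The `d = 3` input sits inside
`dichotomy_of_instances` (`Σ_IR 1/|k| = O(L·M²)`).
[cite: Stringari1995, §2.3 (19)–(23); LiebSeiringerYngvason2005, Thm 6.2; LSSY2005, Thm 2.2 (2.14)] -/
theorem stub_densityUniformDichotomy (v : ℝ → ℝ≥0∞) (hv : IsRepulsiveFiniteRange v)
    (hfin : ∀ r, v r ≠ ⊤) (hC2 : ContDiff ℝ 2 (fun x : Space => (v ‖x‖).toReal))
    (hedge : ∃ Cₑ : ℝ, ∀ x : Space,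
      ‖iteratedFDeriv ℝ 2 (fun x : Space => (v ‖x‖).toReal) x‖ ≤ Cₑ * Real.sqrt ((v ‖x‖).toReal))
    (hLW : ∀ K : ℝ, 0 < K → ∀ ε : ℝ, 0 < ε → ∃ ρ₀ : ℝ, 0 < ρ₀ ∧ ∀ N : ℕ, 0 < N → ∀ L : ℝ, 0 < L →
      (N : ℝ) / L ^ 3 < ρ₀ → L ≤ K ^ 2 * (N : ℝ) * (scatteringLength v).toReal →
      ∀ Ψ : PeriodicTrialState N L,
        periodicEnergy v Ψ = periodicGroundStateEnergy v N L → periodicEnergy v Ψ ≠ ⊤ →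
        (let ρL : ℝ := (N : ℝ) / L ^ 3
         let ℓ : ℝ := (K * Real.sqrt (ρL * (scatteringLength v).toReal))⁻¹
         (∫⁻ u in cell L, ∫⁻ X in cellN N L,
            (∑ j : Fin N, ∑' m : Fin 3 → ℤ,
                (slidingBox ℓ u).indicator (fun _ => (1 : ℝ≥0∞)) (X j + latticeVec L m)) ^ 2 *
              (‖Ψ.ψ X‖₊ : ℝ≥0∞) ^ 2) ≤
           ENNReal.ofReal ((1 + ε) * (ρL * ℓ ^ 3) ^ 2 * L ^ 3)))
    (hR : ∀ Λ : ℝ, 0 < Λ → ∀ ε : ℝ, 0 < ε → ∃ ρ₀ : ℝ, 0 < ρ₀ ∧ ∀ᶠ N : ℕ in atTop, ∀ L : ℝ,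
      sideLength ρ₀ N ≤ L → ∀ Ψ : PeriodicTrialState N L,
        periodicEnergy v Ψ = periodicGroundStateEnergy v N L → periodicEnergy v Ψ ≠ ⊤ →
        (∑' n : Fin 3 → ℤ,
          {n : Fin 3 → ℤ | n ≠ 0 ∧ ‖((2 * Real.pi / L) • latticeVec 1 n)‖ <
              Λ * Real.sqrt ((N : ℝ) / L ^ 3 * (scatteringLength v).toReal)}.indicator
            (fun n =>
              (∫⁻ X in cellN N L,
                  (‖∑ j : Fin N,
                      (cellWave L n (X j) *
                          ((-2 * Complex.I) * fderiv ℝ Ψ.ψ X (Pi.single j ((2 * Real.pi / L) • latticeVec 1 n)) +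
                            (((‖((2 * Real.pi / L) • latticeVec 1 n)‖ ^ 2 : ℝ)) : ℂ) *
                              (Ψ.ψ X - (((L ^ 3)⁻¹ : ℝ) : ℂ) * ∫ y in cell L, Ψ.ψ (Function.update X j y))) +
                        (((‖((2 * Real.pi / L) • latticeVec 1 n)‖ ^ 2 : ℝ)) : ℂ) *
                          ((((L ^ 3)⁻¹ : ℝ) : ℂ) *
                            ∫ y in cell L, cellWave L n y * Ψ.ψ (Function.update X j y)))‖₊ : ℝ≥0∞) ^ 2) /
                  ENNReal.ofReal (‖((2 * Real.pi / L) • latticeVec 1 n)‖ ^ 4) +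
                (∫⁻ X in cellN N L,
                  (‖∑ j : Fin N,
                      (cellWave L n (X j) *
                          (Ψ.ψ X - (((L ^ 3)⁻¹ : ℝ) : ℂ) * ∫ y in cell L, Ψ.ψ (Function.update X j y)) -
                        (((L ^ 3)⁻¹ : ℝ) : ℂ) *
                          ∫ y in cell L, cellWave L n y * Ψ.ψ (Function.update X j y))‖₊ : ℝ≥0∞) ^ 2))
            n) ≤
          ENNReal.ofReal (ε * (N : ℝ) ^ 2))
    (hC : ∀ ζ : ℝ, 0 < ζ → ∃ ρ₀ : ℝ, 0 < ρ₀ ∧ ∀ᶠ n : ℕ in atTop, ∀ L : ℝ, sideLength ρ₀ (n + 2) ≤ L →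
      ∀ Ψ : PeriodicTrialState (n + 2) L,
        periodicEnergy v Ψ = periodicGroundStateEnergy v (n + 2) L → periodicEnergy v Ψ ≠ ⊤ →
        ((n + 2 : ℕ) : ℝ≥0∞) * ((n + 1 : ℕ) : ℝ≥0∞) *
              (∫⁻ Y in cellN n L,
                (‖∫ x in cell L, ∫ y in cell L, Ψ.ψ (vecCons x (vecCons y Y))‖₊ : ℝ≥0∞) ^ 2) /
            ENNReal.ofReal (L ^ 6) +
          condensateOccupation (n + 2) L Ψ.ψ ≤
        condensateOccupation (n + 2) L Ψ.ψ ^ 2 + ENNReal.ofReal (ζ * ((n : ℝ) + 2) ^ 2)) :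
    ∃ ρ₀ : ℝ, 0 < ρ₀ ∧ ∀ᶠ N : ℕ in atTop, ∀ L : ℝ, sideLength ρ₀ N ≤ L →
      ∀ Ψ : PeriodicTrialState N L,
        periodicEnergy v Ψ = periodicGroundStateEnergy v N L → periodicEnergy v Ψ ≠ ⊤ →
        condensateOccupation N L Ψ.ψ ≤ ENNReal.ofReal ((N : ℝ) / 4) ∨
          ENNReal.ofReal (3 * (N : ℝ) / 4) ≤ condensateOccupation N L Ψ.ψ := by
  have hcont : Continuous fun x : Space => (v ‖x‖).toReal := hC2.continuous
  obtain ⟨hmeas, R₀₀, hR₀₀⟩ := id hv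
  set R₀ : ℝ := max R₀₀ 1 with hR₀def
  have hR₀ : 0 < R₀ := lt_of_lt_of_le one_pos (le_max_right _ _)
  have hRv : ∀ r, R₀ < r → v r = 0 := fun r hr => hR₀₀ r (lt_of_le_of_lt (le_max_left _ _) hr)
  by_cases ha0 : scatteringLength v = 0
  · -- the free case: every minimiser is fully condensed
    have h0 : ∀ x : Space, v ‖x‖ = 0 := pot_eq_zero_of_scatteringLength_eq_zero hv hfin hcont ha0
    refine ⟨1, one_pos, ?_⟩
    filter_upwards [eventually_gt_atTop 0] with N hN L hLle Ψ hΨ hΨfin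
    have hL1 : 0 < sideLength 1 N := Real.rpow_pos_of_pos (div_pos (Nat.cast_pos.2 hN) one_pos) _
    have hL : 0 < L := lt_of_lt_of_le hL1 hLle
    exact Or.inr (dud_free_case hv hfin hC2 hedge h0 hL Ψ hΨ)
  · -- the interacting case
    have hatop : scatteringLength v ≠ ⊤ := hv.scatteringLength_ne_top
    set a : ℝ := (scatteringLength v).toReal with hadef
    have ha : 0 < a := ENNReal.toReal_pos ha0 hatop
    obtain ⟨Cₑ₀, hCₑ₀⟩ := id hedge
    set Cₑ : ℝ := max Cₑ₀ 0 with hCₑdef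
    have hCₑ : 0 ≤ Cₑ := le_max_right _ _
    have hedge' : ∀ x : Space, ‖iteratedFDeriv ℝ 2 (fun x : Space => (v ‖x‖).toReal) x‖ ≤
        Cₑ * Real.sqrt ((v ‖x‖).toReal) :=
      fun x => (hCₑ₀ x).trans (mul_le_mul_of_nonneg_right (le_max_left _ _) (Real.sqrt_nonneg _))
    set Λ : ℝ := Real.sqrt (1024 * Real.pi * R₀ / a) with hΛdef
    have hΛ : 0 < Λ := by rw [hΛdef]; exact Real.sqrt_pos.2 (by positivity)
    have hΛ2 : Λ ^ 2 * a = 1024 * Real.pi * R₀ := by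
      rw [hΛdef, Real.sq_sqrt (by positivity)]; field_simp
    -- the thresholds
    obtain ⟨ρV, hρV, hVev⟩ := hC (1 / 64) (by norm_num)
    obtain ⟨ρR, hρR, hRev⟩ := hR Λ hΛ (1 / 64) (by norm_num)
    obtain ⟨ρW, hρW, hWc⟩ := hLW Λ hΛ (25 / 4096) (by norm_num)
    obtain ⟨ρE, hρE, hEc⟩ := dud_groundStateEnergy_le hR₀
    obtain ⟨ρg, hρg, hg⟩ := exists_errorThreshold Λ a R₀ Cₑ
    have hρ₇pos : 0 < (4 * R₀ ^ 2 * Λ ^ 2 * a)⁻¹ := by positivity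
    obtain ⟨ρm, hρm0, hmV, hmR, hmW, hmE, hmg, hm7⟩ : ∃ ρm : ℝ, 0 < ρm ∧ ρm ≤ ρV ∧ ρm ≤ ρR ∧ ρm ≤ ρW ∧
        ρm ≤ ρE ∧ ρm ≤ ρg ∧ ρm ≤ (4 * R₀ ^ 2 * Λ ^ 2 * a)⁻¹ :=
      ⟨min (min (min ρV ρR) (min ρW ρE)) (min ρg (4 * R₀ ^ 2 * Λ ^ 2 * a)⁻¹),
        lt_min (lt_min (lt_min hρV hρR) (lt_min hρW hρE)) (lt_min hρg hρ₇pos),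
        (min_le_left _ _).trans ((min_le_left _ _).trans (min_le_left _ _)),
        (min_le_left _ _).trans ((min_le_left _ _).trans (min_le_right _ _)),
        (min_le_left _ _).trans ((min_le_right _ _).trans (min_le_left _ _)),
        (min_le_left _ _).trans ((min_le_right _ _).trans (min_le_right _ _)),
        (min_le_right _ _).trans (min_le_left _ _),
        (min_le_right _ _).trans (min_le_right _ _)⟩
    have hρ₀ : 0 < ρm / 2 := half_pos hρm0
    refine ⟨ρm / 2, hρ₀, ?_⟩
    -- one `N`-threshold: those of S2 and S3, and `sideLength (ρm/2) N > 4R₀`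
    have hTL := tendsto_sideLength_atTop hρ₀
    have hev := (((tendsto_add_atTop_nat 2).eventually hRev).and
      ((tendsto_add_atTop_nat 2).eventually (hTL.eventually_gt_atTop (4 * R₀)))).and hVev
    rw [Filter.eventually_atTop] at hev ⊢
    obtain ⟨n₀, hn₀⟩ := hev
    refine ⟨n₀ + 2, fun N hN => ?_⟩
    obtain ⟨n, rfl⟩ : ∃ n, N = n + 2 := ⟨N - 2, by omega⟩
    obtain ⟨⟨hR', h4R⟩, hV'⟩ := hn₀ n (by omega)
    intro L hLle Ψ hΨ hΨfin
    have hL4 : 4 * R₀ < L := lt_of_lt_of_le h4R hLle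
    have hL : 0 < L := by linarith
    have h2R : 2 * R₀ < L := by linarith
    -- the local density
    set ρ : ℝ := ((n + 2 : ℕ) : ℝ) / L ^ 3 with hρdef
    have hρ : 0 < ρ := by rw [hρdef]; positivity
    have hρle : ρ ≤ ρm / 2 := dud_density_le_of_sideLength_le hρ₀ (by positivity) hLle
    have hρlt : ρ < ρm := by linarith
    have hρL3 : ρ * L ^ 3 = (n + 2 : ℕ) := by rw [hρdef]; exact div_mul_cancel₀ _ (by positivity)
    have hRℓ : 2 * R₀ ≤ (Λ * Real.sqrt (ρ * a))⁻¹ := two_mul_le_ell hΛ ha hR₀ hρ (by linarith)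
    have hLR : sideLength ρR (n + 2) ≤ L := (sideLength_le_sideLength hρ₀ (by linarith) _).trans hLle
    have hLV : sideLength ρV (n + 2) ≤ L := (sideLength_le_sideLength hρ₀ (by linarith) _).trans hLle
    -- the `C³` minimiser and its energy budget
    obtain ⟨Ψm, hEm, hfinm, hC3⟩ := minimiserRegularity_proof v hv hfin hC2 hedge (n + 2) (by positivity) L hL
    have hbudget : periodicEnergy v Ψm ≤ ENNReal.ofReal (16 * Real.pi * R₀ * ρ * ((n + 2 : ℕ) : ℝ)) := by
      rw [hEm]; exact hEc (n + 2) (by omega) L hL4 (by linarith) v hRv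
    have hVm := hV' L hLV Ψm hEm hfinm
    -- the dichotomy for `Ψm`
    have hdich : condensateOccupation (n + 2) L Ψm.ψ ≤ ENNReal.ofReal (((n + 2 : ℕ) : ℝ) / 4) ∨
        ENNReal.ofReal (3 * ((n + 2 : ℕ) : ℝ) / 4) ≤ condensateOccupation (n + 2) L Ψm.ψ := by
      by_cases hM : 1 ≤ L * (Λ * Real.sqrt (ρ * a)) / (2 * Real.pi)
      · -- non-empty infrared window: the engine `dichotomy_of_instances` at `t = 1`
        have hK₀ : 0 < Λ * Real.sqrt (ρ * a) := by positivity
        have h1 : 2 * Real.pi ≤ L * (Λ * Real.sqrt (ρ * a)) := by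
          rwa [le_div_iff₀ (by positivity), one_mul] at hM
        have hℓL : (Λ * Real.sqrt (ρ * a))⁻¹ < L := by
          rw [inv_eq_one_div, div_lt_iff₀ hK₀]
          nlinarith [Real.pi_gt_three]
        have hside : L ≤ Λ ^ 2 * ((n + 2 : ℕ) : ℝ) * a := by
          have hpi : (1 : ℝ) ≤ (2 * Real.pi) ^ 2 := by nlinarith [Real.pi_gt_three]
          have h2 : (2 * Real.pi) ^ 2 ≤ (L * (Λ * Real.sqrt (ρ * a))) ^ 2 :=
            pow_le_pow_left₀ (by positivity) h1 2
          have h3 : (L * (Λ * Real.sqrt (ρ * a))) ^ 2 = L ^ 2 * (Λ ^ 2 * a) * ρ := by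
            rw [mul_pow, mul_pow, Real.sq_sqrt (by positivity : (0 : ℝ) ≤ ρ * a)]; ring
          calc L = L * 1 := (mul_one L).symm
            _ ≤ L * (2 * Real.pi) ^ 2 := mul_le_mul_of_nonneg_left hpi hL.le
            _ ≤ L * (L * (Λ * Real.sqrt (ρ * a))) ^ 2 := mul_le_mul_of_nonneg_left h2 hL.le
            _ = Λ ^ 2 * (ρ * L ^ 3) * a := by rw [h3]; ring
            _ = Λ ^ 2 * ((n + 2 : ℕ) : ℝ) * a := by rw [hρL3]
        refine dichotomy_of_instances hmeas hRv hR₀ hfin hC2 hCₑ hedge' ha hΛ hΛ2 hρ one_pos le_rfl hL hρL3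
          h2R hℓL hRℓ hM (hg ρ hρ (by linarith)) Ψm ?_ ?_ ?_ ?_ hVm
        · rw [smul_one_eq v]; exact hbudget
        · intro p hp
          have hE1 : periodicEnergy (fun r => ENNReal.ofReal 1 * v r) Ψm =
              periodicGroundStateEnergy (fun r => ENNReal.ofReal 1 * v r) (n + 2) L := by
            rw [smul_one_eq v]; exact hEm
          have hfin1 : periodicEnergy (fun r => ENNReal.ofReal 1 * v r) Ψm ≠ ⊤ := by
            rw [smul_one_eq v]; exact hfinm
          exact currentSumRule_proof v hv hfin hC2 hedge R₀ hR₀ hRv 1 one_pos le_rfl (n + 2) L h2R Ψm hC3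
            hE1 hfin1 p hp
        · exact hR' L hLR Ψm hEm hfinm
        · exact hWc (n + 2) (by positivity) L hL (by linarith) hside Ψm hEm hfinm
      · -- empty infrared window: the ultra-dilute tail
        push Not at hM
        exact dud_dichotomy_of_emptyWindow hL hR₀ ha hΛ hΛ2 hρ hρL3 hM Ψm hbudget hVm
    -- transfer to the given minimiser
    rw [dud_condensateOccupation_eq_of_minimisers hv hfin hC2 hedge hL Ψ Ψm hΨ hΨfin hEm]
    exact hdich

end Summit.AtomisticToContinuum.BoseEinsteinCondensation.Theorems.CorrectorClosure.VolumeHomotopySumRuleDomination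

end
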